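import Literature.AnabelianGeometry.EtaleTheta.RealifiedDivisorMonoidsOfRlfR
import Literature.AnabelianGeometry.EtaleTheta.RealifiedDivisorMonoidsOfRlfQ

/-!
# [EtTh] Def 3.6 (i) / Prop 3.4 (ii): inverse-closure of `F₀^Λ` (`hFinv`) at the CONSTRUCTED realified
# data `ofRlfZ`, `ofRlfQ`, `ofRlfR`

S. Mochizuki, *The étale theta function …*, Publ. RIMS **45** (2009) [MochizukiEtTh2009], Prop. 3.4 (ii)
third isomorphism, PDF p.74 ("`L^× ⥲ F₀(Y^log) ⊆ B₀(Y^log)`" — the constant log-meromorphic functions form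
a GROUP) and Def. 3.6 (i), PDF p.76 ("`F₀^ℤ := F₀`; `F₀^ℚ := F₀^pf`; `F₀^ℝ := ℝ·Φ₀^cnst ⊆ (Φ₀^ℝ)^gp`").

The binder `hFinv : ∀ Y b, b ∈ F₀^Λ(Y) → ∃ b' ∈ F₀^Λ(Y), b'·b = 1` ("`F₀^Λ(Y)` is inverse-closed in the
group-like `B₀^Λ(Y)`") is the one residual of [EtTh] Rmk 3.6.3 at the tree's vocabulary
(`Discharge/Sec3Remark363.lean`, `TemperedFrobenioid.remark363_of_prop34Cnst`; cell GAP-LEDGER G-w5d135-1;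
necessary over the typed interface: `TemperedFrobenioidToyFinv.lean`) and an alternative third input of
`Discharge/Sec3Def36NonzeroConstants.lean`.  Over abc-iut-L2-t3's abstract `RealifiedDivisorMonoids` it is
not derivable (`FΛ` is a bare submonoid).  This proof-only file settles it for the three CONSTRUCTED
Def. 3.6 (i) data of abc-iut-L6-t12 (`RealifiedDivisorMonoids.ofRlfZ` / `ofRlfQ` / `ofRlfR`, built from
Def. 3.3 (iii) data `dm : DivisorMonoids` with Prop. 3.4 (i)):

* `ofRlfR_hFinv` — `Λ = ℝ`: UNCONDITIONAL (`F₀^ℝ = ℝ·Φ₀^cnst` is the preimage of a subgroup of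
  `(Φ₀^ℝ)^gp` in the group `B₀^ℝ = ℝ·Φ₀^birat`);
* `ofRlfZ_hFinv_iff` — `Λ = ℤ`: `hFinv` is LITERALLY the `B₀`-level statement
  `hF₀inv : ∀ Y b, b ∈ F₀(Y) → ∃ b' ∈ F₀(Y), b'·b = 1` ("`F₀(Y) ≅ L^×` is a subgroup of `B₀(Y)`"), a property
  of the Def. 3.3 (iii) data that `DivisorMonoids` / `DivisorMonoids.Prop34` do not record (it is what a
  geometric instantiation supplies: the constant functions are the image of a field's unit group);
* `ofRlfQ_hFinv_of` — `Λ = ℚ`: `hF₀inv → hFinv` (the perfection of an inverse-closed submonoid is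
  inverse-closed: `(c'·c = 1) ⇒ (c')^{1/n}·c^{1/n} = 1`).

HONEST FRAMING: refereed pre-IUT material ([EtTh] §3); nothing here bears on [IUTchIII] Cor. 3.12; the
`Λ = ℤ, ℚ` cases stay conditional on the displayed `B₀`-level binder.
-/

noncomputable section

namespace Literature.AnabelianGeometry.EtaleTheta

open CategoryTheory Opposite Literature.AlgebraicGeometry.Frobenioids

universe u v w

namespace RealifiedDivisorMonoids

variable {D₀ : Type u} [Category.{v} D₀] (dm : DivisorMonoids.{u, v, w} D₀)
  (hpf : ∀ Y : D₀ᵒᵖ, IsPerfFactorial (dm.Φ₀.obj Y))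

/-! ## `Λ = ℝ`: unconditional -/

/-- **`hFinv` for `ofRlfR` — `F₀^ℝ(Y) = ℝ·Φ₀^cnst(Y)` is inverse-closed in `B₀^ℝ(Y) = ℝ·Φ₀^birat(Y)`**,
unconditionally: `F₀^ℝ` is the preimage under `B₀^ℝ ⊆ (Φ₀^ℝ)^gp` of the subgroup `ℝ·Φ₀^cnst`, and `B₀^ℝ` is
a group. [cite: MochizukiEtTh2009, Def 3.6 p.76] -/
theorem ofRlfR_hFinv (Y : D₀ᵒᵖ) (b : (ofRlfR dm hpf).BΛ.obj Y) (hb : b ∈ (ofRlfR dm hpf).FΛ Y) :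
    ∃ b' ∈ (ofRlfR dm hpf).FΛ Y, b' * b = 1 := by
  obtain ⟨u, hu⟩ := (ofRlfR dm hpf).isUnit_BΛ Y b
  refine ⟨↑u⁻¹, ?_, by rw [← hu, Units.inv_mul]⟩
  -- in the group `B₀^ℝ(Y) = ℝ·Φ₀^birat(Y)` (a subgroup of `(Φ₀^ℝ)^gp(Y)`), `↑u⁻¹` has underlying class
  -- `(class of b)⁻¹`, which lies in the subgroup `ℝ·Φ₀^cnst(Y)` together with the class of `b`
  have h2 : (↑u⁻¹ : (ofRlfR dm hpf).BΛ.obj Y) * b = 1 := by rw [← hu, Units.inv_mul]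
  have h3 : Subtype.val (↑u⁻¹ : (ofRlfR dm hpf).BΛ.obj Y) * Subtype.val b = 1 :=
    congrArg Subtype.val h2
  have h4 : Subtype.val (↑u⁻¹ : (ofRlfR dm hpf).BΛ.obj Y) = (Subtype.val b)⁻¹ :=
    eq_inv_of_mul_eq_one_left h3
  change Subtype.val (↑u⁻¹ : (ofRlfR dm hpf).BΛ.obj Y) ∈
    (((realData dm hpf).realSpan dm.cnstGp).carrier (unop Y)).toSubmonoid
  rw [h4]
  exact ((realData dm hpf).realSpan dm.cnstGp).carrier (unop Y) |>.inv_mem hb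

/-- `hFinv` for `ofRlfR`, in the binder shape of `Sec3Remark363` / `Sec3Def36NonzeroConstants`.
[cite: MochizukiEtTh2009, Def 3.6 p.76] -/
theorem ofRlfR_hFinv' :
    ∀ (Y : D₀ᵒᵖ) (b : (ofRlfR dm hpf).BΛ.obj Y), b ∈ (ofRlfR dm hpf).FΛ Y →
      ∃ b' ∈ (ofRlfR dm hpf).FΛ Y, b' * b = 1 :=
  fun Y b hb => ofRlfR_hFinv dm hpf Y b hb

/-! ## `Λ = ℤ`: literally the `B₀`-level statement -/

/-- **`hFinv` for `ofRlfZ` IS the `B₀`-level inverse-closure of `F₀`** (`B₀^ℤ = B₀`, `F₀^ℤ = F₀`): the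
binder `hF₀inv` — "`F₀(Y) ≅ L^×` is a subgroup of `B₀(Y)`", Prop 3.4 (ii) third isomorphism — which the
Def 3.3 (iii) interface `DivisorMonoids` does not record. [cite: MochizukiEtTh2009, Prop 3.4 (ii) p.74] -/
theorem ofRlfZ_hFinv_iff :
    (∀ (Y : D₀ᵒᵖ) (b : (ofRlfZ dm hpf).BΛ.obj Y), b ∈ (ofRlfZ dm hpf).FΛ Y →
        ∃ b' ∈ (ofRlfZ dm hpf).FΛ Y, b' * b = 1) ↔
      ∀ (Y : D₀ᵒᵖ) (b : dm.B₀.obj Y), b ∈ dm.F₀ Y → ∃ b' ∈ dm.F₀ Y, b' * b = 1 :=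
  Iff.rfl

/-! ## `Λ = ℚ`: from the `B₀`-level statement -/

/-- **`hFinv` for `ofRlfQ` from the `B₀`-level inverse-closure of `F₀`** (`B₀^ℚ = B₀^pf`,
`F₀^ℚ = F₀^pf = ` the image of `F₀(Y)^pf → B₀(Y)^pf`): if `c'·c = 1` in `F₀(Y)` then
`(c')^{1/n}·c^{1/n} = 1` in `B₀(Y)^pf`. [cite: MochizukiEtTh2009, Def 3.6 p.76] -/
theorem ofRlfQ_hFinv_of
    (hF₀inv : ∀ (Y : D₀ᵒᵖ) (b : dm.B₀.obj Y), b ∈ dm.F₀ Y → ∃ b' ∈ dm.F₀ Y, b' * b = 1)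
    (Y : D₀ᵒᵖ) (b : (ofRlfQ dm hpf).BΛ.obj Y) (hb : b ∈ (ofRlfQ dm hpf).FΛ Y) :
    ∃ b' ∈ (ofRlfQ dm hpf).FΛ Y, b' * b = 1 := by
  obtain ⟨x, rfl⟩ := hb
  obtain ⟨⟨c, n⟩, rfl⟩ := Perfection.mk_surjective x
  obtain ⟨c', hc'F, hc'⟩ := hF₀inv Y (c : dm.B₀.obj Y) c.2
  have hcc : (⟨c', hc'F⟩ : dm.F₀ Y) * c = 1 := Subtype.ext hc'
  refine ⟨Perfection.map (dm.F₀ Y).subtype (Perfection.mk ⟨c', hc'F⟩ n), ⟨_, rfl⟩, ?_⟩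
  show Perfection.map (dm.F₀ Y).subtype (Perfection.mk ⟨c', hc'F⟩ n) *
      Perfection.map (dm.F₀ Y).subtype (Perfection.mk c n) = (1 : Perfection (dm.B₀.obj Y))
  rw [← map_mul, Perfection.mk_mul_mk, ← mul_pow, Perfection.mk_pow_mul, hcc, Perfection.mk_one, map_one]

/-- `hFinv` for `ofRlfQ` from `hF₀inv`, in the binder shape of `Sec3Remark363` / `Sec3Def36NonzeroConstants`.
[cite: MochizukiEtTh2009, Def 3.6 p.76] -/
theorem ofRlfQ_hFinv_of'
    (hF₀inv : ∀ (Y : D₀ᵒᵖ) (b : dm.B₀.obj Y), b ∈ dm.F₀ Y → ∃ b' ∈ dm.F₀ Y, b' * b = 1) :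
    ∀ (Y : D₀ᵒᵖ) (b : (ofRlfQ dm hpf).BΛ.obj Y), b ∈ (ofRlfQ dm hpf).FΛ Y →
      ∃ b' ∈ (ofRlfQ dm hpf).FΛ Y, b' * b = 1 :=
  fun Y b hb => ofRlfQ_hFinv_of dm hpf hF₀inv Y b hb

end RealifiedDivisorMonoids

end Literature.AnabelianGeometry.EtaleTheta
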